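import Summits.ResolutionOfSingularities.ResolutionOfSingularities.Theorems.AbhyankarShadowsShadowsUniformizeCompositeResidueDiscrete
import Literature.AlgebraicGeometry.Resolution.LocalUniformizationAbhyankarPlaces
import Literature.AlgebraicGeometry.Resolution.CompositeValuations
import HarnessLib

/-!
# The residue side of a composite valuation, Abhyankar case (`stub_composite_residue_abhyankar`)

Stub of the birth line of the crux `ShadowsUniformize` (stmt-ResolutionOfSingularities-16756, route
`AbhyankarShadows`), composite-uniformizable branch (c3). In the Novacoski–Spivakovsky
decomposition `ν = ν₁ ∘ ν₂` of a valuation ring `O ⊇ k` of a function field `K/k` (`k`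
algebraically closed) along a coarsening `O ≤ O₁`, the residue valuation `ν₂` has valuation ring
`O₂ := O / m_{O₁} = residueValuationSubring O O₁ hO` inside the residue field `κ(O₁)`. The
composition lemma hands over an abstract field `κ` with a `k`-algebra structure and a
`k`-compatible SURJECTIVE (hence bijective) homomorphism `ι : κ → κ(O₁)`, and asks for relative
local uniformization of the valuation ring `O₂' := ι⁻¹(O₂)` of `κ` over `k`.

When `O₂'` is an ABHYANKAR place of `κ | k` (equality in Abhyankar's inequality) this is
Knaf–Kuhlmann 2005, Thm. 1.1 with Cor. 2.2 (PROVED in the tree, affine-model form over a perfect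
ground field: `relLU_at_abhyankarPlace_of_perfectField`,
`LocalUniformizationAbhyankarPlaces.lean`) applied to `(κ, O₂')`; this file checks its two
remaining hypotheses with the helpers of the discrete sibling
(`AbhyankarShadowsShadowsUniformizeCompositeResidueDiscrete.lean`):

* `fg_top_of_surjective` — `κ | k` is finitely generated: `κ(O₁)` is generated over `k` by the
  residues of finitely many elements of `O` (hypothesis `hgen`), and `ι` is a bijection;
* `algebraMap_mem_comap_residueValuationSubring` — `k ⊆ O₂'`.

`k` is perfect as an algebraically closed field (`IsAlgClosed.perfectField`). No named facts are
used.

## Sources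

* [KK05] H. Knaf, F.-V. Kuhlmann, *Abhyankar places admit local uniformization in any
  characteristic*, Ann. Sci. ÉNS 38 (2005) 833–846: Thm. 1.1, Cor. 2.2. [KnafKuhlmann2005]
* [NS14] J. Novacoski, M. Spivakovsky, *Reduction of local uniformization to the rank one case*,
  2014: §2.1, Remark 2.4 (the decomposition `ν = ν₁ ∘ ν₂`). [NovacoskiSpivakovsky2014]
-/

noncomputable section

-- single-problem summit: the doubled namespace component is forced
set_option linter.dupNamespace false

open Literature.AlgebraicGeometry.Resolution IsLocalRing

namespace Summit.ResolutionOfSingularities.ResolutionOfSingularities.Theorems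

/-- **STUB (c3; the residue side, Abhyankar case).** For `k ⊆ O ≤ O₁` in `K` with `k`
algebraically closed and `κ(O₁)` generated over `k` by residues of finitely many elements of `O`:
through any `k`-compatible surjective (hence bijective) `ι : κ → κ(O₁)`, if the valuation ring
`ι⁻¹(O / m_{O₁})` of `κ` is an ABHYANKAR place of `κ | k`, then it admits relative local
uniformization over `k` — `κ/k` is finitely generated (`fg_top_of_surjective`), `ι⁻¹(O / m_{O₁})`
contains `k` (`algebraMap_mem_comap_residueValuationSubring`), and `k` is perfect, so
Knaf–Kuhlmann 2005 Thm. 1.1 (`relLU_at_abhyankarPlace_of_perfectField`, proved in the tree)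
applies. [cite: KnafKuhlmann2005, Thm. 1.1 and Cor. 2.2] -/
theorem stub_composite_residue_abhyankar (k K : Type) [Field k] [IsAlgClosed k] [Field K]
    [Algebra k K] (O O₁ : ValuationSubring K) (hO : O ≤ O₁) (hk : ∀ c : k, algebraMap k K c ∈ O)
    (hgen : ∃ S : Finset O, ∀ T : Subfield (IsLocalRing.ResidueField O₁),
      (∀ c : k, IsLocalRing.residue O₁ ⟨algebraMap k K c, hO (hk c)⟩ ∈ T) →
      (∀ s ∈ S, IsLocalRing.residue O₁ ⟨(s : K), hO s.2⟩ ∈ T) → T = ⊤)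
    (κ : Type) [Field κ] [Algebra k κ] (ι : κ →+* IsLocalRing.ResidueField O₁)
    (hι : Function.Surjective ι)
    (hιk : ∀ c : k, ι (algebraMap k κ c) = IsLocalRing.residue O₁ ⟨algebraMap k K c, hO (hk c)⟩)
    (hA : IsAbhyankarPlace ((residueValuationSubring O O₁ hO).comap ι)
      (algebraMap k κ).fieldRange ⊤)
    (R : Subalgebra k κ) (hR : R.FG)
    (hRO : R.toSubring ≤ ((residueValuationSubring O O₁ hO).comap ι).toSubring) :
    ∃ (B : Subalgebra k κ) (hB : B.toSubring ≤ ((residueValuationSubring O O₁ hO).comap ι).toSubring),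
      R ≤ B ∧ B.FG ∧ IsRegularLocalRing (Localization.AtPrime (Ideal.comap (Subring.inclusion hB)
        (IsLocalRing.maximalIdeal ((residueValuationSubring O O₁ hO).comap ι)))) := by
  classical
  -- (i) `κ | k` is finitely generated
  obtain ⟨S, hS⟩ := hgen
  have hfg : (⊤ : IntermediateField k κ).FG :=
    fg_top_of_surjective ι hι S (fun s : O => residue O₁ ⟨(s : K), hO s.2⟩)
      (fun T h₁ h₂ => hS T (fun c => by rw [← hιk]; exact h₁ c) h₂)
  -- (ii) constants
  have hk' : ∀ c : k, algebraMap k κ c ∈ (residueValuationSubring O O₁ hO).comap ι :=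
    algebraMap_mem_comap_residueValuationSubring O O₁ hO hk ι hιk
  -- (iii) `k` is perfect; Knaf–Kuhlmann 2005, Thm. 1.1 on `(κ, ι⁻¹(O / m_{O₁}))`
  haveI : PerfectField k := IsAlgClosed.perfectField k
  obtain ⟨B, hB, hRB, hBfg, -, hreg⟩ :=
    relLU_at_abhyankarPlace_of_perfectField hfg _ hk' hA R hR hRO
  exact ⟨B, hB, hRB, hBfg, hreg⟩

end Summit.ResolutionOfSingularities.ResolutionOfSingularities.Theorems

end
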